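import Summits.KontsevichZagierPeriods.KontsevichZagierPeriods.Theorems.RootDecompZetaThreeFrontierWordRungTwoP2

/-! # `RootDecompZetaThreeFrontierWordRungTwoP3` — part 3/12 of the mechanical ≤270-line split of `RungTwo.stripped.lean`
(split by the decomp-kz census seat for landing; mathematics unchanged; part 3 continues part 2). -/

noncomputable section

namespace Summit.KontsevichZagierPeriods.RootDecompZetaThreeFrontier.WordLayer
open Set MeasureTheory MvPolynomial
open Literature.NumberTheory.Transcendental
open Summit.KontsevichZagierPeriods.KontsevichZagierPeriods.Theses.RootDecompZetaThreeFrontier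
  (HigherWeightDescent)
open Summit.KontsevichZagierPeriods.KontsevichZagierPeriods.Theses.LinRedNormalForm
  (DihedralNormalForm MzvKernelInKZ HoffmanSpanInKZ HoffmanIndependence)

section RungOne
open Literature.ModelTheory.ExponentialFields (IsSemialgebraic)

/-! (private copy of `strictAnti_fin_one` — its public twin in this chain was privatised under the dedup.landed policy) -/
/-- Auxiliary step `strictAnti_fin_one`. [bookkeeping] -/
private theorem strictAnti_fin_one (y : Fin 1 → ℝ) : StrictAnti y := fun a b hab =>
  absurd hab (by rw [Subsingleton.elim a b]; exact lt_irrefl _)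

/-! (private copy of `mem_simplex_one_iff` — its public twin in this chain was privatised under the dedup.landed policy) -/
/-- Membership in `simplex_one_iff`, unfolded. [bookkeeping] -/
private theorem mem_simplex_one_iff (y : Fin 1 → ℝ) : y ∈ KZ.openOrderedSimplex 1 ↔ 0 < y 0 ∧ y 0 < 1 := by
  constructor
  · rintro ⟨h0, h1, -⟩
    exact ⟨h0 0, h1 0⟩
  · rintro ⟨h0, h1⟩
    refine ⟨fun i => ?_, fun i => ?_, strictAnti_fin_one y⟩
    · rw [Fin.fin_one_eq_zero i]; exact h0
    · rw [Fin.fin_one_eq_zero i]; exact h1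

/-- pole test at `0`: if `m ≤ |M y|` on `(0, η)` with `0 < m`, `0 < η ≤ 1` and `1 ≤ b`, then
`y ↦ M y / y ^ b` is not integrable on `(0, η)` (comparison with `y⁻¹ = y ^ (-1 : ℝ)`). -/
private theorem not_integrableOn_pole {M : ℝ → ℝ} {m η : ℝ} {b : ℕ} (hm : 0 < m) (hη : 0 < η)
    (hη1 : η ≤ 1) (hb : 1 ≤ b) (hM : ∀ y ∈ Ioo 0 η, m ≤ |M y|) :
    ¬ IntegrableOn (fun y => M y / y ^ b) (Ioo 0 η) := by
  intro h
  have hinv : IntegrableOn (fun y : ℝ => y⁻¹) (Ioo 0 η) := by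
    refine Integrable.mono' (h.integrable.norm.const_mul m⁻¹) measurable_inv.aestronglyMeasurable
      ((ae_restrict_iff' measurableSet_Ioo).2 (Filter.Eventually.of_forall fun y hy => ?_))
    have hy0 : 0 < y := hy.1
    have hy1 : y ≤ 1 := hy.2.le.trans hη1
    have hyb : y ^ b ≤ y := by simpa using pow_le_pow_of_le_one hy0.le hy1 hb
    have key : m / y ≤ |M y| / y ^ b := div_le_div₀ (abs_nonneg _) (hM y hy) (pow_pos hy0 b) hyb
    rw [Real.norm_eq_abs, abs_inv, abs_of_pos hy0, Real.norm_eq_abs, abs_div,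
      abs_of_pos (pow_pos hy0 b)]
    calc y⁻¹ = m⁻¹ * (m / y) := by field_simp
      _ ≤ m⁻¹ * (|M y| / y ^ b) := mul_le_mul_of_nonneg_left key (inv_nonneg.2 hm.le)
  have h' : IntegrableOn (fun y : ℝ => y ^ (-1 : ℝ)) (Ioo 0 η) :=
    hinv.congr_fun (fun y _ => (Real.rpow_neg_one y).symm) measurableSet_Ioo
  have := (intervalIntegral.integrableOn_Ioo_rpow_iff (s := -1) hη).1 h'
  exact lt_irrefl _ this

/-- a function continuous at `0` with `M 0 ≠ 0` stays bounded below in absolute value near `0` -/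
private theorem abs_ge_near_zero {M : ℝ → ℝ} (hM : ContinuousAt M 0) (h0 : M 0 ≠ 0) :
    ∃ η : ℝ, 0 < η ∧ η ≤ 1 ∧ ∀ y ∈ Ioo 0 η, |M 0| / 2 ≤ |M y| := by
  have hε : 0 < |M 0| / 2 := half_pos (abs_pos.2 h0)
  obtain ⟨δ, hδ, hδ'⟩ := Metric.continuousAt_iff.1 hM _ hε
  refine ⟨min δ 1, lt_min hδ one_pos, min_le_right _ _, fun y hy => ?_⟩
  have hyδ : dist y 0 < δ := by
    rw [Real.dist_eq, sub_zero, abs_of_pos hy.1]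
    exact hy.2.trans_le (min_le_left _ _)
  have h1 := hδ' hyδ
  rw [Real.dist_eq] at h1
  have h2 := abs_sub_abs_le_abs_sub (M 0) (M y)
  rw [abs_sub_comm] at h2
  linarith

/-- **divisibility at `0` forced by integrability**: if `P(y) / (y ^ b · D y)` is integrable on `(0,1)`
with `D` continuous and non-vanishing at `0` (and on `(0,1)`), then `y ^ b` cancels: the function
equals `P₁(y) / D y` on `(0,1)` for a polynomial `P₁` (induction on `b`, `Polynomial.X_dvd_iff`). -/
theorem poly_cancel_zero (D : ℝ → ℝ) (hD : ContinuousAt D 0) (hD0 : D 0 ≠ 0)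
    (hD1 : ∀ y ∈ Ioo (0:ℝ) 1, D y ≠ 0) :
    ∀ (b : ℕ) (P : Polynomial ℚ),
      IntegrableOn (fun y : ℝ => Polynomial.aeval y P / (y ^ b * D y)) (Ioo 0 1) →
      ∃ P₁ : Polynomial ℚ, ∀ y ∈ Ioo (0:ℝ) 1,
        Polynomial.aeval y P / (y ^ b * D y) = Polynomial.aeval y P₁ / D y := by
  intro b
  induction b with
  | zero => exact fun P _ => ⟨P, fun y _ => by rw [pow_zero, one_mul]⟩
  | succ b ih =>
    intro P hP
    -- the constant coefficient of `P` vanishes, else the pole at `0` is not integrable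
    have hc : P.coeff 0 = 0 := by
      by_contra hne
      have hP0 : Polynomial.aeval (0:ℝ) P ≠ 0 := by
        rw [← Polynomial.coeff_zero_eq_aeval_zero' (A := ℝ), eq_ratCast, Rat.cast_ne_zero]
        exact hne
      have hMc : ContinuousAt (fun y : ℝ => Polynomial.aeval y P / D y) 0 :=
        (Polynomial.continuousAt_aeval (p := P)).div₀ hD hD0
      have hM0 : (fun y : ℝ => Polynomial.aeval y P / D y) 0 ≠ 0 := div_ne_zero hP0 hD0
      obtain ⟨η, hη, hη1, hMη⟩ := abs_ge_near_zero hMc hM0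
      refine not_integrableOn_pole (half_pos (abs_pos.2 hM0)) hη hη1 (Nat.succ_le_succ b.zero_le)
        hMη ((hP.mono_set (Ioo_subset_Ioo_right hη1)).congr_fun (fun y _ => ?_) measurableSet_Ioo)
      show Polynomial.aeval y P / (y ^ (b + 1) * D y) = Polynomial.aeval y P / D y / y ^ (b + 1)
      rw [div_div, mul_comm (D y)]
    obtain ⟨P₂, rfl⟩ := Polynomial.X_dvd_iff.2 hc
    have heq : ∀ y ∈ Ioo (0:ℝ) 1, Polynomial.aeval y (Polynomial.X * P₂) / (y ^ (b + 1) * D y) =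
        Polynomial.aeval y P₂ / (y ^ b * D y) := by
      intro y hy
      rw [map_mul, Polynomial.aeval_X, pow_succ]
      field_simp [hy.1.ne', hD1 y hy]
    obtain ⟨P₁, hP₁⟩ := ih P₂ ((hP.congr_fun heq measurableSet_Ioo))
    exact ⟨P₁, fun y hy => (heq y hy).trans (hP₁ y hy)⟩

/-- reflection `y ↦ 1 - y` preserves integrability on `(0,1)` (Lebesgue measure is translation- and
negation-invariant). -/
private theorem integrableOn_reflect {g : ℝ → ℝ} (hg : IntegrableOn g (Ioo 0 1)) :
    IntegrableOn (fun y => g (1 - y)) (Ioo 0 1) := by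
  have hpre : (fun y : ℝ => 1 - y) ⁻¹' Ioo (0:ℝ) 1 = Ioo 0 1 := by
    ext y; simp only [mem_preimage, mem_Ioo]; constructor <;> rintro ⟨h1, h2⟩ <;> constructor <;>
      linarith
  have := (MeasurePreserving.integrableOn_comp_preimage
    (Measure.measurePreserving_sub_left volume (1:ℝ)) (measurableEmbedding_subLeft (1:ℝ))
    (f := g) (s := Ioo 0 1)).2 hg
  rw [hpre] at this
  exact this

/-- **An integrable `P(y) / (y ^ b (1 - y) ^ c)` on `(0,1)` is a polynomial there**: both poles cancel. -/
theorem poly_of_integrable (P : Polynomial ℚ) (b c : ℕ)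
    (h : IntegrableOn (fun y : ℝ => Polynomial.aeval y P / (y ^ b * (1 - y) ^ c)) (Ioo 0 1)) :
    ∃ P' : Polynomial ℚ, ∀ y ∈ Ioo (0:ℝ) 1,
      Polynomial.aeval y P / (y ^ b * (1 - y) ^ c) = Polynomial.aeval y P' := by
  -- cancel the pole at `0`
  have hD : ContinuousAt (fun y : ℝ => (1 - y) ^ c) 0 :=
    ((continuous_const.sub continuous_id).pow c).continuousAt
  obtain ⟨P₁, hP₁⟩ := poly_cancel_zero (fun y => (1 - y) ^ c) hD (by simp)
    (fun y hy => pow_ne_zero _ (sub_ne_zero.2 hy.2.ne')) b P h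
  -- reflect and cancel the pole at `1`
  have h₁ : IntegrableOn (fun y : ℝ => Polynomial.aeval y P₁ / (1 - y) ^ c) (Ioo 0 1) :=
    h.congr_fun hP₁ measurableSet_Ioo
  have h₂ : IntegrableOn (fun y : ℝ =>
      Polynomial.aeval y (P₁.comp (Polynomial.C 1 - Polynomial.X)) / (y ^ c * 1)) (Ioo 0 1) := by
    refine (integrableOn_reflect h₁).congr_fun (fun y _ => ?_) measurableSet_Ioo
    simp only [Polynomial.aeval_comp, map_sub, map_one, Polynomial.aeval_X, sub_sub_cancel, mul_one]
  obtain ⟨Q₁, hQ₁⟩ := poly_cancel_zero (fun _ => (1:ℝ)) continuousAt_const one_ne_zero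
    (fun _ _ => one_ne_zero) c _ h₂
  refine ⟨Q₁.comp (Polynomial.C 1 - Polynomial.X), fun y hy => ?_⟩
  have hy' : 1 - y ∈ Ioo (0:ℝ) 1 := ⟨by linarith [hy.2], by linarith [hy.1]⟩
  have := hQ₁ (1 - y) hy'
  simp only [Polynomial.aeval_comp, map_sub, map_one, Polynomial.aeval_X, sub_sub_cancel, mul_one,
    div_one] at this
  rw [hP₁ y hy, this]
  simp only [Polynomial.aeval_comp, map_sub, map_one, Polynomial.aeval_X]

/-! ### 12b  Dimension `1`: `MvPolynomial (Fin 1)` ↔ `Polynomial`, and the integrability transfer -/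

/-- the univariate polynomial of a `Fin 1`-variable polynomial -/
noncomputable def toPoly (p : MvPolynomial (Fin 1) ℚ) : Polynomial ℚ :=
  MvPolynomial.aeval (fun _ : Fin 1 => (Polynomial.X : Polynomial ℚ)) p

/-- Auxiliary step `aeval_fin_one`. [bookkeeping] -/
theorem aeval_fin_one (p : MvPolynomial (Fin 1) ℚ) (t : Fin 1 → ℝ) :
    MvPolynomial.aeval t p = Polynomial.aeval (t 0) (toPoly p) := by
  have h := DFunLike.congr_fun (MvPolynomial.comp_aeval (R := ℚ)
    (f := fun _ : Fin 1 => (Polynomial.X : Polynomial ℚ)) (Polynomial.aeval (t 0) : Polynomial ℚ →ₐ[ℚ] ℝ)) p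
  rw [AlgHom.comp_apply] at h
  simp only [Polynomial.aeval_X] at h
  have ht : (fun _ : Fin 1 => t 0) = t := funext fun i => congrArg t (Subsingleton.elim 0 i)
  rw [ht] at h
  rw [toPoly]
  exact h.symm

/-- a univariate polynomial as a `Fin 1`-variable polynomial -/
noncomputable def ofPoly (P : Polynomial ℚ) : MvPolynomial (Fin 1) ℚ :=
  Polynomial.aeval (MvPolynomial.X 0 : MvPolynomial (Fin 1) ℚ) P

/-- Auxiliary step `aeval_ofPoly`. [bookkeeping] -/
theorem aeval_ofPoly (P : Polynomial ℚ) (t : Fin 1 → ℝ) :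
    MvPolynomial.aeval t (ofPoly P) = Polynomial.aeval (t 0) P := by
  rw [ofPoly, ← Polynomial.aeval_algHom_apply, MvPolynomial.aeval_X]

/-- the genus-zero form in dimension `1` is `P(t₀) / (t₀ ^ b₀ (1 - t₀) ^ c₀)` -/
theorem gzForm_one (p : MvPolynomial (Fin 1) ℚ) (a : Fin 1 → Fin 1 → ℕ) (b c : Fin 1 → ℕ)
    (t : Fin 1 → ℝ) :
    MvPolynomial.aeval t p / ((∏ i, t i ^ b i) * (∏ i, (1 - t i) ^ c i) *
      ∏ i, ∏ j, if i < j then (t i - t j) ^ a i j else 1) =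
    Polynomial.aeval (t 0) (toPoly p) / ((t 0) ^ (b 0) * (1 - t 0) ^ (c 0)) := by
  simp only [Fin.prod_univ_one, lt_self_iff_false, if_false, mul_one, aeval_fin_one]

/-- integrability transfer `Δ₁ ⊂ (Fin 1 → ℝ)` → `(0,1) ⊂ ℝ` (`MeasureTheory.volume_preserving_funUnique`) -/
private theorem integrableOn_real_of_rep (r : KZ.IntegralRep 1) (F : ℝ → ℝ)
    (hd : r.domain = {t | (∀ i, 0 < t i) ∧ (∀ i, t i < 1) ∧ StrictAnti t})
    (hi : EqOn r.integrand (fun t => F (t 0)) r.domain) : IntegrableOn F (Ioo 0 1) := by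
  have hpre : (MeasurableEquiv.funUnique (Fin 1) ℝ) ⁻¹' Ioo (0:ℝ) 1 = KZ.openOrderedSimplex 1 := by
    ext t
    rw [mem_preimage, mem_simplex_one_iff]
    show t default ∈ Ioo (0:ℝ) 1 ↔ _
    rw [Fin.default_eq_zero]
    exact Iff.rfl
  have hS : MeasurableSet (KZ.openOrderedSimplex 1) :=
    hpre ▸ (MeasurableEquiv.funUnique (Fin 1) ℝ).measurable measurableSet_Ioo
  have hd' : r.domain = KZ.openOrderedSimplex 1 := hd
  have h0 : IntegrableOn r.integrand (KZ.openOrderedSimplex 1) := hd' ▸ r.integrableOn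
  have hi' : EqOn r.integrand (fun t => F (t 0)) (KZ.openOrderedSimplex 1) := hd' ▸ hi
  have h1 : IntegrableOn (fun t : Fin 1 → ℝ => F (t 0)) (KZ.openOrderedSimplex 1) :=
    h0.congr_fun hi' hS
  have h2 : IntegrableOn (F ∘ ⇑(MeasurableEquiv.funUnique (Fin 1) ℝ))
      ((MeasurableEquiv.funUnique (Fin 1) ℝ) ⁻¹' Ioo 0 1) := by
    rw [hpre]
    refine h1.congr_fun (fun t _ => ?_) hS
    show F (t 0) = F (t default)
    rw [Fin.default_eq_zero]
  exact (MeasurePreserving.integrableOn_comp_preimage (volume_preserving_funUnique (Fin 1) ℝ)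
    (MeasurableEquiv.funUnique (Fin 1) ℝ).measurableEmbedding).1 h2

/-! ### 12c  The rung `K = 1` -/

/-- dimension `1`: every genus-zero representation is congruent to a weight-`0` word generator -/
theorem gz_one (r : KZ.IntegralRep 1) (p : MvPolynomial (Fin 1) ℚ)
    (a : Fin 1 → Fin 1 → ℕ) (b c : Fin 1 → ℕ)
    (hd : r.domain = {t | (∀ i, 0 < t i) ∧ (∀ i, t i < 1) ∧ StrictAnti t})
    (hi : EqOn r.integrand (fun t => MvPolynomial.aeval t p / ((∏ i, t i ^ b i) *
      (∏ i, (1 - t i) ^ c i) * ∏ i, ∏ j, if i < j then (t i - t j) ^ a i j else 1)) r.domain) :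
    ∃ m ∈ wordGensLE 0, KZ.of r - m ∈ KZ.relations := by
  -- (1) the integrand is `P(t₀)/(t₀^b₀ (1-t₀)^c₀)`, integrable on `(0,1)`
  have hiF : EqOn r.integrand (fun t => (fun y : ℝ =>
      Polynomial.aeval y (toPoly p) / (y ^ (b 0) * (1 - y) ^ (c 0))) (t 0)) r.domain :=
    fun t ht => by rw [hi ht]; exact gzForm_one p a b c t
  obtain ⟨P', hP'⟩ := poly_of_integrable (toPoly p) (b 0) (c 0) (integrableOn_real_of_rep r _ hd hiF)
  -- (2) so `r` carries the FREE genus-zero datum `(ofPoly P', a, 0, 0)`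
  have hi' : EqOn r.integrand (fun t => MvPolynomial.aeval t (ofPoly P') /
      ((∏ i, t i ^ (0 : Fin 1 → ℕ) i) * (∏ i, (1 - t i) ^ (0 : Fin 1 → ℕ) i) *
        ∏ i, ∏ j, if i < j then (t i - t j) ^ a i j else 1)) r.domain := by
    intro t ht
    have ht' : t 0 ∈ Ioo (0:ℝ) 1 := by
      have h := ht; rw [hd] at h; exact ⟨h.1 0, h.2.1 0⟩
    rw [hiF ht]
    show Polynomial.aeval (t 0) (toPoly p) / ((t 0) ^ (b 0) * (1 - t 0) ^ (c 0)) = _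
    rw [hP' (t 0) ht']
    simp only [Pi.zero_apply, pow_zero, Finset.prod_const_one, one_mul, Fin.prod_univ_one,
      lt_self_iff_false, if_false, div_one, aeval_ofPoly]
  -- (3) one Newton–Leibniz move (landed support collapse, weight-`0` column)
  exact gz_free r (ofPoly P') a 0 0 (fun i => ⟨rfl, rfl, fun j =>
    ⟨fun h => absurd (Subsingleton.elim i j ▸ h) (lt_irrefl _),
     fun h => absurd (Subsingleton.elim j i ▸ h) (lt_irrefl _)⟩⟩) hd hi'

/-- **Rung `K = 1` of the ladder `GZNormalFormW`, decided in full.** -/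
theorem gzNormalFormW_one : GZNormalFormW 1 := by
  intro k hk r p a b c hd hi
  rcases Nat.le_one_iff_eq_zero_or_eq_one.1 hk with rfl | rfl
  · exact ⟨KZ.of r, AddSubgroup.subset_closure (of_mem_wordGensLE_zero r p a b c hd hi), by simp⟩
  · obtain ⟨m, hm, hrel⟩ := gz_one r p a b c hd hi
    exact ⟨m, AddSubgroup.subset_closure (wordGensLE_mono (Nat.zero_le 1) hm), hrel⟩

/-! ### 12d  The weight-`1` slice of the divergence move -/

end RungOne
/-! ## §12f  The rung-2 specimen DECIDED in the kernel (gen 9):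
`[Δ₂, t₁(1-t₀)/(t₀²(1-t₁)²)] ≡ [Δ₂, ω₀ω₁] - [pt, 1]` by absolutely convergent moves

Six moves, every intermediate representation absolutely convergent: (1b) split `M = ∂₁F + R`;
(3) Newton–Leibniz in `t₁` with the diagonal-interpolated primitive `F` — ZERO boundary values, so
`[Δ₂, ∂₁F] ≡ 0`; (1b) `R = ω₀ω₁ - t₁/(t₀²(1-t₁))` (both pieces dominated by `ω₀ω₁`); (2) the duality
involution `(t₀,t₁) ↦ (1-t₁, 1-t₀)` of `Δ₂` (`|det| = 1` because it is an involution) carries the last piece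
to `(1-u₀)/(u₀(1-u₁)²)`; (3) Newton–Leibniz in `u₁` with the RATIONAL primitive `(1-u₀)/u₀ · u₁/(1-u₁)`,
fibre values `0` and `1`; (3) `[Δ₁, -1] ≡ [pt, -1]`, and `[pt,-1] + [pt,1] ≡ 0`. -/

end Summit.KontsevichZagierPeriods.RootDecompZetaThreeFrontier.WordLayer
end
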